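/-
Copyright: the b2b-balaban cell (near-miss cell 7), T⁴-continuum fan-out, lineage t4-ne7b-p3 (node U5c LARGE-DEVIATION
member P3).  Released under the licence of the surrounding project.
-/
import Summits.QuantumFields.BalabanUV.T4Continuum.Support.HistoryLevels

/-!
# Space-time Peierls ∕ Cramér route for NE7b — THE LEVEL DATA OF THE FLOW: the model scale of the COUNT swarm and the
# window exponents extended beyond the cutoff supply the level hypotheses of the occupancy instance

Summits-side support leaf of the T⁴-continuum cell (rung (B)+1 on a FINITE torus only; NOT infinite volume, NOT the
mass gap, NOT the Clay statement; NOT a proof of the spine estimate NE7b).  Lineage `t4-ne7b-p3` (generation 2), node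
U5c, skeleton `t4/skeletons/NE7b-t4-ne7b-p3.md` §11 (hypothesis group (vii) of `LinData.lineageReadings`).
[folklore] arithmetic over the COUNT member's `HistoryLevels` (`HistoryZones.levelOf`, `levelFn_levelOf`, lineage
t4-ne7b-p1, BY NAME) and `Lit.B16SProfile` (`ratio`, `qexp`, `DropCtl`); nothing printed is asserted; no `[cite:]` tag.

WHAT.  The occupancy instance (`SpaceTimeOccTorus` ∕ `SpaceTimeInstance`) asks of the levels `ℓ` and ratios `q`:
`ℓ` monotone with jumps `≤ 2`, `ℓ u ≤ Kx` on `u ≤ K`, `q u = L^{ℓ(u+1) − ℓ u}` for all `u`, `q = ratio L σ` with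
`DropCtl σ m`, `K ≤ m`.  Here, from window exponents `s` stepwise non-increasing on `[0, K]` with `DropCtl s K` (the
typed flow facts, `HistoryLevels.windowExp_succ_le` ∕ `Lit.B16SProfile.dropCtl_of_27b`):
* §1 `extExp s K u := s (min u K)` — the exponents frozen beyond the cutoff; `dropCtl_extExp : DropCtl (extExp s K) m`
  for every `m`;
* §2 with `ℓ := HistoryZones.levelOf s K` (`= u + s u − s K` below `K`, `= u` beyond) and `Kx := K`:
  `levelOf_mono'`, `levelOf_jump`, `levelOf_le_cutoff` (from `levelFn_levelOf`) and
  **`ratio_extExp_eq : ratio L (extExp s K) u = L ^ (levelOf s K (u+1) − levelOf s K u)`** for all `u`.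

HONEST DEPENDENCY (cell, verbatim): continuum YM on T⁴ ⇐ BetaPertH ∧ nine spine estimates (0/9 proved); BetaPertH ⇐
(D1) ∧ (D4) ∧ CAP+tail; G-an2-4 gates asym, D1 and NE2/3/4.  This file changes none of it.
-/

namespace Summit.QuantumFields.BalabanUV.T4Continuum.SpaceTimePeierls

open Literature.MathematicalPhysics.QuantumFieldTheory.Balaban1983to89.B16SProfile
open Summit.QuantumFields.BalabanUV.T4Continuum.HistoryZones

/-! ## §1 The window exponents frozen beyond the cutoff -/

section Ext

variable {s : ℕ → ℕ} {K : ℕ}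

/-- **THE EXTENDED WINDOW EXPONENT**: `s` on `[0, K]`, frozen at `s K` beyond the cutoff. [folklore] -/
def extExp (s : ℕ → ℕ) (K : ℕ) : ℕ → ℕ := fun u => s (min u K)

/-- below the cutoff the extension is `s` [folklore] -/
theorem extExp_of_le {u : ℕ} (hu : u ≤ K) : extExp s K u = s u := by
  simp [extExp, min_eq_left hu]

/-- beyond the cutoff the extension is `s K` [folklore] -/
theorem extExp_of_ge {u : ℕ} (hu : K ≤ u) : extExp s K u = s K := by
  simp [extExp, min_eq_right hu]

/-- **THE DROP CONTROL SURVIVES THE EXTENSION**, to every horizon. [folklore] -/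
theorem dropCtl_extExp (h : DropCtl s K) (m : ℕ) : DropCtl (extExp s K) m := by
  intro i k hik _hkm
  rcases Nat.lt_or_ge K k with hkK | hkK
  · rw [extExp_of_ge hkK.le]
    rcases Nat.lt_or_ge i K with hiK | hiK
    · rw [extExp_of_le hiK.le]
      have h1 := h i K hiK le_rfl
      have h2 : max (K - i) 2 ≤ max (k - i) 2 := max_le_max (by omega) le_rfl
      omega
    · rw [extExp_of_ge hiK]
      exact Nat.le_add_right _ _
  · rw [extExp_of_le hkK, extExp_of_le (by omega : i ≤ K)]
    exact h i k hik hkK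

end Ext

/-! ## §2 The model scale supplies the level hypotheses -/

section Levels

variable {s : ℕ → ℕ} {K : ℕ}

/-- the model scale is monotone [folklore] -/
theorem levelOf_mono' (hs : ∀ t, t < K → s (t + 1) ≤ s t) (hdrop : DropCtl s K) (u : ℕ) :
    levelOf s K u ≤ levelOf s K (u + 1) :=
  (levelFn_levelOf hs hdrop).mono u

/-- the model scale rises by at most one (hence at most two) per step [folklore] -/
theorem levelOf_jump (hs : ∀ t, t < K → s (t + 1) ≤ s t) (hdrop : DropCtl s K) (u : ℕ) :
    levelOf s K (u + 1) ≤ levelOf s K u + 2 :=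
  ((levelFn_levelOf hs hdrop).lip u).trans (Nat.add_le_add_left (by norm_num) _)

/-- the model scale of a step `≤ K` is `≤ K` (the torus exponent `Kx = K`) [folklore] -/
theorem levelOf_le_cutoff (hs : ∀ t, t < K → s (t + 1) ≤ s t) (hdrop : DropCtl s K) (u : ℕ) (hu : u ≤ K) :
    levelOf s K u ≤ K :=
  (levelFn_levelOf hs hdrop).le_K u hu

/-- **THE TYPED RATIO IS THE LEVEL JUMP**: `ratio L (extExp s K) u = L ^ (levelOf s K (u+1) − levelOf s K u)` for every
`u` (below the cutoff: `q_u = L^{s_{u+1} + 1 − s_u}` and the level rises by `1 + s_{u+1} − s_u`; beyond: both are `L`).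
[folklore] -/
theorem ratio_extExp_eq (hs : ∀ t, t < K → s (t + 1) ≤ s t) (hdrop : DropCtl s K) (L u : ℕ) :
    ratio L (extExp s K) u = L ^ (levelOf s K (u + 1) - levelOf s K u) := by
  unfold ratio qexp
  congr 1
  rcases Nat.lt_or_ge u K with huK | huK
  · have hu1 : u + 1 ≤ K := huK
    rw [extExp_of_le hu1, extExp_of_le huK.le, levelOf_of_le hu1, levelOf_of_le huK.le]
    have h1 : s u ≤ s (u + 1) + 1 := hdrop.lag_one hu1
    have h2 : s (u + 1) ≤ s u := hs u huK
    have h3 : s K ≤ s (u + 1) := windowExp_le_of_le hs hu1 le_rfl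
    omega
  · rw [extExp_of_ge huK, extExp_of_ge (by omega : K ≤ u + 1), levelOf_of_ge huK,
      levelOf_of_ge (by omega : K ≤ u + 1)]
    omega

end Levels

end Summit.QuantumFields.BalabanUV.T4Continuum.SpaceTimePeierls
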